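import Literature.MathematicalPhysics.StatisticalMechanics.NJLChiralCondensateLowerBound
import Literature.MathematicalPhysics.StatisticalMechanics.ComplexSpinFluctuationFiveSixCertificate
import Literature.Probability.LatticeModels.LatticeGreenThreeCertificate
import HarnessLib

/-!
# Chiral symmetry breaking in strongly coupled lattice QED and the NJL system, hypothesis-free:
# Salmhofer–Seiler's Corollary 4.4 (1), second paragraph (CMP 139 (1991), p. 419)

A short file of the Salmhofer–Seiler series; theorems only (no definition, no named fact).
`NJLChiralCondensateLowerBound` proves Theorem 4.3 (4.8) and Corollary 4.4 (1) (4.16) under the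
printed hypothesis `2S(ν)/N < 1`.  Corollary 4.4 (1) continues: "In the case `N = 1`, which is
strongly coupled (compact or noncompact) QED, `2S(ν)/N < 1` holds for all `ν ≥ 4`, so chiral
symmetry is broken for all `ν ≥ 4`.  If `N ≥ 2` the breaking of the symmetry holds for all `ν ≥ 3`."
The numerical input is in the tree as kernel certificates: `S(ν) < 0.35` for all `ν ≥ 4`
(`ComplexSpinFluctuationFiveSixCertificate.fluctS_lt_of_four_le`, Prop. 4.2 (4)) and, for `ν = 3`,
`S(3) ≤ 3R(3) - 3/4 ≤ 0.778` (`ComplexSpinFluctuationBound.fluctS_le` with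
`LatticeGreenThreeCertificate.three_mul_latticeGreen_three_zero_le`, Remark A.5 / (A.61)).  Hence:

* `two_mul_fluctS_div_lt_one` — `2S(ν)/N < 1` whenever `ν ≥ 4`, or `ν ≥ 3` and `N ≥ 2`;
* `njl_chiralSymmetryBreaking` — for these `N, ν` the thermodynamic limit `s(m)` of the condensate
  `⟨σ_x⟩_Λ(m)` (Cor. 3.9) obeys `s(m) ≥ s₂(m) > 0` for every `m > 0`, and
  `njl_chiralOrderParameter_pos` — `liminf_{m→0+} s(m) ≥ (1/√(2ν))(1 - 2S(ν)/N)^{1/2} > 0`: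
  the chiral order parameter `X = liminf_{m→0}⟨ψ̄ψ⟩` is positive;
* `qed_chiralSymmetryBreaking` — the case `N = 1`, `ν ≥ 4` (strongly coupled lattice QED), stated
  for the tree's `U(1)` data `uNBondCoeff 1` (`= njlBondCoeff 1`, Remark 3.4 (1)).

The one case the print leaves open, `N = 1`, `ν = 3` (`2S(3) ≈ 1.26 > 1`), stays open here.
Faithfulness / scope: `β = 0`, `g₄ = 0`, even tori, real mass, limits along even tori; nothing about
`β > 0`, the continuum, a mass gap or the summit's `QCD` conjunct.

## References

* M. Salmhofer, E. Seiler, *Proof of chiral symmetry breaking in strongly coupled lattice gauge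
  theory*, Commun. Math. Phys. 139 (1991) 395–432: Cor. 4.4 (1) p. 419, Prop. 4.2 (4), Remark A.5,
  (A.60)–(A.61), table p. 430. [SalmhoferSeiler1991]
-/

noncomputable section

open MvPolynomial Finset Filter Topology
open Literature.Probability.LatticeModels (TorusSite Site)
open Literature.Probability.LatticeModels

namespace Literature.MathematicalPhysics.StatisticalMechanics

namespace ComplexSpin

variable {ν N : ℕ}

/-- **`S(3) ≤ 0.778`**: the antipodal-free bound `S(ν) ≤ νR(ν) - 3/4` ((A.61) / Remark A.5) at
`ν = 3` with the certified `3R(3) ≤ 1.528` (Watson's integral, p. 430). [cite: SalmhoferSeiler1991, Remark A.5 and (A.61) with p. 430] -/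
theorem fluctS_three_le : fluctS 3 ≤ 389 / 500 := by
  have h1 := fluctS_le (ν := 3) le_rfl
  have h2 := three_mul_latticeGreen_three_zero_le
  push_cast at h1
  linarith

/-- **The numerical hypothesis of Cor. 4.4 (1)**: `2S(ν)/N < 1` for all `ν ≥ 4` (`S(ν) < 0.35`,
Prop. 4.2 (4)), and for `ν = 3` as soon as `N ≥ 2` (`S(3) ≤ 0.778`). [cite: SalmhoferSeiler1991, Cor. 4.4 (1) with Prop. 4.2 (4)] -/
theorem two_mul_fluctS_div_lt_one (hν : 3 ≤ ν) (hN : 1 ≤ N) (h : 4 ≤ ν ∨ 2 ≤ N) :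
    2 * fluctS ν / N < 1 := by
  have hNpos : (0 : ℝ) < N := by exact_mod_cast hN
  have hN1 : (1 : ℝ) ≤ N := by exact_mod_cast hN
  have hS0 : 0 ≤ fluctS ν := fluctS_nonneg ν
  rw [div_lt_one hNpos]
  rcases Nat.lt_or_ge ν 4 with hν3 | hν4
  · -- `ν = 3`, so `N ≥ 2`
    have hν3' : ν = 3 := by omega
    subst hν3'
    have hN2 : (2 : ℝ) ≤ N := by
      rcases h with h | h
      · omega
      · exact_mod_cast h
    linarith [fluctS_three_le]
  · linarith [fluctS_lt_of_four_le hν4]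

/-- **Corollary 4.4 (1), second paragraph: chiral symmetry breaking for the NJL system /
strongly coupled `U(N)` lattice gauge theory, hypothesis-free.**  For `ν ≥ 4` and every `N ≥ 1`,
and for `ν = 3` and every `N ≥ 2`: the condensate `s(m) = lim_Λ ⟨σ_x⟩_Λ(m)` (along every sequence
of tori, Cor. 3.9) satisfies `s₂(m) ≤ s(m) ≤ s₁(m)` and `s(m) > 0` for all `m > 0`, with the
mean-field roots `s₁`, `s₂` of (4.7), (4.9). [cite: SalmhoferSeiler1991, Cor. 4.4 (1) with Thm. 4.3] -/
theorem njl_chiralSymmetryBreaking (hν : 3 ≤ ν) (hN : 1 ≤ N) (h : 4 ≤ ν ∨ 2 ≤ N) :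
    ∃ s : ℝ → ℝ,
      (∀ (Ls : ℕ → ℕ) [∀ j, NeZero (Ls j)], Tendsto Ls atTop atTop → ∀ m : ℝ, m ≠ 0 →
        Tendsto (fun j => expect (ν := ν) (L := Ls j) N m (njlBondCoeff N) (X 0)) atTop
          (𝓝 (s m))) ∧
      ∀ m : ℝ, 0 < m →
        (Real.sqrt (m ^ 2 + 2 * ν * (1 - 2 * fluctS ν / N)) - m) / (2 * ν) ≤ s m ∧
          s m ≤ (Real.sqrt (m ^ 2 + 2 * ν) - m) / (2 * ν) ∧ 0 < s m :=
  njl_condensate_bounds hν hN (two_mul_fluctS_div_lt_one hν hN h)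

/-- **Corollary 4.4 (1), second paragraph, for the chiral order parameter**: for `ν ≥ 4`, `N ≥ 1`,
or `ν = 3`, `N ≥ 2`, and any `s(m)` which is for each `m > 0` the limit of `⟨σ_0⟩_Λ(m)` along some
sequence of even tori of diverging side: `liminf_{m→0+} s(m) ≥ (1/√(2ν))(1 - 2S(ν)/N)^{1/2} > 0` —
`X = liminf_{m→0}⟨ψ̄ψ⟩ > 0`, chiral symmetry is broken. [cite: SalmhoferSeiler1991, Cor. 4.4 (1) (4.16)] -/
theorem njl_chiralOrderParameter_pos (hν : 3 ≤ ν) (hN : 1 ≤ N) (h : 4 ≤ ν ∨ 2 ≤ N)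
    {s : ℝ → ℝ}
    (hs : ∀ m : ℝ, 0 < m → ∃ (Ls : ℕ → ℕ) (_ : ∀ j, NeZero (Ls j)),
      (∀ j, Even (Ls j)) ∧ Tendsto Ls atTop atTop ∧
        Tendsto (fun j => expect (ν := ν) (L := Ls j) N m (njlBondCoeff N) (X 0)) atTop
          (𝓝 (s m))) :
    1 / Real.sqrt (2 * ν) * Real.sqrt (1 - 2 * fluctS ν / N) ≤ liminf s (𝓝[>] 0) ∧
      0 < liminf s (𝓝[>] 0) := by
  have hb := njl_chiralOrderParameter_bounds hν hN (two_mul_fluctS_div_lt_one hν hN h) hs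
  exact ⟨hb.1, hb.2.2⟩

/-- **Strongly coupled lattice QED (`N = 1`), `ν ≥ 4`: chiral symmetry is broken** — "In the case
`N = 1`, which is strongly coupled (compact or noncompact) QED, `2S(ν)/N < 1` holds for all `ν ≥ 4`,
so chiral symmetry is broken for all `ν ≥ 4`": for the tree's `U(1)` complex spin system
(`uNBondCoeff 1`, which IS the `N = 1` NJL system, Remark 3.4 (1)) the condensate
`s(m) = lim_Λ ⟨σ_x⟩_Λ(m)` exists for all real `m ≠ 0` and satisfies
`s(m) ≥ (√(m² + 2ν(1 - 2S(ν))) - m)/(2ν) > 0` for every `m > 0`. [cite: SalmhoferSeiler1991, Cor. 4.4 (1) with Remark 3.4 (1)] -/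
theorem qed_chiralSymmetryBreaking (hν : 4 ≤ ν) :
    ∃ s : ℝ → ℝ,
      (∀ (Ls : ℕ → ℕ) [∀ j, NeZero (Ls j)], Tendsto Ls atTop atTop → ∀ m : ℝ, m ≠ 0 →
        Tendsto (fun j => expect (ν := ν) (L := Ls j) 1 m (uNBondCoeff 1) (X 0)) atTop
          (𝓝 (s m))) ∧
      ∀ m : ℝ, 0 < m →
        (Real.sqrt (m ^ 2 + 2 * ν * (1 - 2 * fluctS ν)) - m) / (2 * ν) ≤ s m ∧ 0 < s m := by
  obtain ⟨s, hs, hb⟩ := njl_chiralSymmetryBreaking (ν := ν) (N := 1) (by omega) le_rfl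
    (Or.inl hν)
  refine ⟨s, fun Ls _ hLs m hm => ?_, fun m hm => ?_⟩
  · have h := hs Ls hLs m hm
    refine h.congr fun j => ?_
    rw [expect_uN_one_eq_njl]
  · have h := hb m hm
    simp only [Nat.cast_one, div_one] at h
    exact ⟨h.1, h.2.2⟩

end ComplexSpin

end Literature.MathematicalPhysics.StatisticalMechanics
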